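/-
Origin: expansion seat `planner-pub-hodgecm-toy-0`, handover #2 2026-08-18T04:13:45Z (`HOME/pub-hodgecm-toy/lean/Toy/BaseChange.lean`, md5 30b98a56, 192 lines);
landed by the gen-5 packager in gate run 21 as `HodgeCM/Model/Toy/BaseChange.lean` (import ^import Toy\.→import HodgeCM.Model.Toy. ×1).
-/
-- HANDOVER (planner-pub-hodgecm-toy-0, unit pub-hodgecm-toy): WIP module `Toy.BaseChange`; intended final module
-- `HodgeCM.Model.Toy.BaseChange` (kind L5, toy model / consistency witness); rename `import Toy.X` ↦ the final prefix.
/-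
Copyright: pub-hodgecm cell (HodgeCMPerL). Consistency-witness layer (part (e), referee A G4).

# Base change of exterior powers

For fields `R ⊆ A` and a finite-dimensional `R`-space `M`, the canonical `A`-linear isomorphism
`Θ_k : A ⊗_R ⋀^k_R M ≃ ⋀^k_A (A ⊗_R M)`, `a ⊗ (v₁ ∧ … ∧ v_k) ↦ a • (1 ⊗ v₁) ∧ … ∧ (1 ⊗ v_k)`, with its
naturality and multiplicativity. (Mathlib has no base change for exterior powers at the pinned commit.)
-/
import Mathlib
import Summits.HodgeConjecture.HodgeCM.Model.Toy.Exterior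

/-! PORT of `HodgeCM/Model/Toy/BaseChange.lean` (HodgeCMPerL run 81) — verbatim mechanical port; provenance in the PORT header line. -/

namespace HodgeCM.Toy

open scoped TensorProduct
open exteriorPower

noncomputable section

namespace BC

variable (R A : Type*) [Field R] [Field A] [Algebra R A]
variable (M : Type*) [AddCommGroup M] [Module R M]
variable {N : Type*} [AddCommGroup N] [Module R N]

/-- The scalar tower `R → A → ⋀_A N` (Mathlib's instance for `CliffordAlgebra` does not fire here). -/
instance towerExt (N : Type*) [AddCommGroup N] [Module A N] [Module R N] [IsScalarTower R A N] :
    IsScalarTower R A (ExteriorAlgebra A N) := RingCon.instIsScalarTowerQuotient _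

/-- (Ported verbatim from the HodgeCMPerL package; no docstring in the source.) -/
lemma comp_append {α β : Type*} {m n : ℕ} (h : α → β) (a : Fin m → α) (b : Fin n → α) :
    h ∘ Fin.append a b = Fin.append (h ∘ a) (h ∘ b) := by
  funext x
  refine Fin.addCases (fun i => ?_) (fun i => ?_) x <;> simp

/-- `(v₁ ∧ … ∧ v_i) ∧ (w₁ ∧ … ∧ w_j) = v₁ ∧ … ∧ w_j`. -/
lemma wedge_ιMulti {S : Type*} [CommRing S] {P : Type*} [AddCommGroup P] [Module S P] (i j : ℕ)
    (v : Fin i → P) (w : Fin j → P) :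
    wedge S P i j (ιMulti S i v) (ιMulti S j w) = ιMulti S (i + j) (Fin.append v w) := by
  apply Subtype.ext
  simp only [wedge_coe, ιMulti_apply_coe, ExteriorAlgebra.ιMulti_apply]
  rw [← List.prod_append, ← List.ofFn_fin_append]
  congr 2
  funext x
  refine Fin.addCases (fun l => ?_) (fun l => ?_) x <;> simp

/-- `v ↦ (1 ⊗ v₁) ∧ … ∧ (1 ⊗ v_k)` as an `R`-alternating map. -/
def thetaAlt (k : ℕ) : M [⋀^Fin k]→ₗ[R] (⋀[A]^k (A ⊗[R] M)) :=
  { ((ιMulti A k).toMultilinearMap.restrictScalars R).compLinearMap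
      (fun _ => TensorProduct.mk R A M 1) with
    map_eq_zero_of_eq' := fun v i j h hij =>
      (ιMulti A k).map_eq_zero_of_eq _ (by simp [h]) hij }

/-- (Ported verbatim from the HodgeCMPerL package; no docstring in the source.) -/
@[simp] lemma thetaAlt_apply (k : ℕ) (v : Fin k → M) :
    thetaAlt R A M k v = ιMulti A k (fun i => (1 : A) ⊗ₜ[R] v i) := rfl

/-- `Θ` on the rational exterior power. -/
def thetaLin (k : ℕ) : (⋀[R]^k M) →ₗ[R] (⋀[A]^k (A ⊗[R] M)) :=
  alternatingMapLinearEquiv (thetaAlt R A M k)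

/-- (Ported verbatim from the HodgeCMPerL package; no docstring in the source.) -/
@[simp] lemma thetaLin_ιMulti (k : ℕ) (v : Fin k → M) :
    thetaLin R A M k (ιMulti R k v) = ιMulti A k (fun i => (1 : A) ⊗ₜ[R] v i) := by
  simp [thetaLin]

/-- **Base change map** `Θ_k : A ⊗_R ⋀^k_R M → ⋀^k_A (A ⊗_R M)`. -/
def theta (k : ℕ) : A ⊗[R] (⋀[R]^k M) →ₗ[A] (⋀[A]^k (A ⊗[R] M)) :=
  (thetaLin R A M k).liftBaseChange A

/-- (Ported verbatim from the HodgeCMPerL package; no docstring in the source.) -/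
@[simp] lemma theta_tmul (k : ℕ) (a : A) (x : ⋀[R]^k M) :
    theta R A M k (a ⊗ₜ x) = a • thetaLin R A M k x := rfl

/-- (Ported verbatim from the HodgeCMPerL package; no docstring in the source.) -/
lemma theta_tmul_ιMulti (k : ℕ) (a : A) (v : Fin k → M) :
    theta R A M k (a ⊗ₜ ιMulti R k v) = a • ιMulti A k (fun i => (1 : A) ⊗ₜ[R] v i) := by
  simp

variable [FiniteDimensional R M]

/-- (Ported verbatim from the HodgeCMPerL package; no docstring in the source.) -/
lemma range_theta (k : ℕ) : LinearMap.range (theta R A M k) = ⊤ := by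
  classical
  let b := Module.finBasis R M
  let bA : Module.Basis (Fin _) A (A ⊗[R] M) := Algebra.TensorProduct.basis A b
  rw [eq_top_iff, ← ιMulti_family_span_of_span A bA.span_eq, Submodule.span_le]
  rintro _ ⟨s, rfl⟩
  refine ⟨(1 : A) ⊗ₜ ιMulti_family R k b s, ?_⟩
  simp only [ιMulti_family, theta_tmul, thetaLin_ιMulti, one_smul]
  congr 1
  funext i
  simp [bA, Algebra.TensorProduct.basis_apply]

/-- (Ported verbatim from the HodgeCMPerL package; no docstring in the source.) -/
lemma finrank_source_eq_target (k : ℕ) :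
    Module.finrank A (A ⊗[R] ⋀[R]^k M) = Module.finrank A (⋀[A]^k (A ⊗[R] M)) := by
  rw [Module.finrank_baseChange, exteriorPower.finrank_eq, exteriorPower.finrank_eq,
    Module.finrank_baseChange]

/-- (Ported verbatim from the HodgeCMPerL package; no docstring in the source.) -/
lemma theta_bijective (k : ℕ) : Function.Bijective (theta R A M k) := by
  have hs : Function.Surjective (theta R A M k) := LinearMap.range_eq_top.mp (range_theta R A M k)
  exact ⟨(LinearMap.injective_iff_surjective_of_finrank_eq_finrank
    (finrank_source_eq_target R A M k)).mpr hs, hs⟩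

/-- **The base-change isomorphism** `Θ_k : A ⊗_R ⋀^k_R M ≃ ⋀^k_A (A ⊗_R M)`. -/
def thetaEquiv (k : ℕ) : A ⊗[R] (⋀[R]^k M) ≃ₗ[A] (⋀[A]^k (A ⊗[R] M)) :=
  LinearEquiv.ofBijective (theta R A M k) (theta_bijective R A M k)

/-- (Ported verbatim from the HodgeCMPerL package; no docstring in the source.) -/
@[simp] lemma thetaEquiv_apply (k : ℕ) (x : A ⊗[R] ⋀[R]^k M) :
    thetaEquiv R A M k x = theta R A M k x := rfl

omit [FiniteDimensional R M] in
/-- Naturality of `Θ`: `Θ ∘ (⋀^k f)_A = ⋀^k (f_A) ∘ Θ`. -/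
lemma theta_naturality (k : ℕ) (f : M →ₗ[R] N) (x : A ⊗[R] ⋀[R]^k M) :
    theta R A N k ((map k f).baseChange A x) = map k (f.baseChange A) (theta R A M k x) := by
  have key : thetaLin R A N k ∘ₗ map k f
      = (map k (f.baseChange A)).restrictScalars R ∘ₗ thetaLin R A M k := by
    apply linearMap_ext
    ext v
    simp only [LinearMap.compAlternatingMap_apply, LinearMap.coe_comp, Function.comp_apply,
      map_apply_ιMulti, thetaLin_ιMulti, LinearMap.coe_restrictScalars, ιMulti_apply_coe]
    congr 1
  induction x using TensorProduct.induction_on with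
  | zero => simp
  | tmul a y =>
      simp only [LinearMap.baseChange_tmul, theta_tmul, map_smul]
      exact congrArg (a • ·) (LinearMap.congr_fun key y)
  | add x y hx hy => simp [map_add, hx, hy]

omit [FiniteDimensional R M] in
/-- Multiplicativity of `Θ` on generators. -/
lemma thetaLin_wedge (i j : ℕ) (x : ⋀[R]^i M) (y : ⋀[R]^j M) :
    ((thetaLin R A M (i + j) (wedge R M i j x y) : ⋀[A]^(i + j) (A ⊗[R] M)) :
        ExteriorAlgebra A (A ⊗[R] M))
      = (thetaLin R A M i x : ExteriorAlgebra A (A ⊗[R] M)) * (thetaLin R A M j y) := by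
  let E := ExteriorAlgebra A (A ⊗[R] M)
  let sub : ∀ n, (⋀[A]^n (A ⊗[R] M)) →ₗ[R] E := fun n => ((⋀[A]^n (A ⊗[R] M)).subtype).restrictScalars R
  let β₁ : (⋀[R]^i M) →ₗ[R] (⋀[R]^j M) →ₗ[R] E :=
    (wedge R M i j).compr₂ (sub (i + j) ∘ₗ thetaLin R A M (i + j))
  let β₂ : (⋀[R]^i M) →ₗ[R] (⋀[R]^j M) →ₗ[R] E :=
    (LinearMap.mul R E).compl₁₂ (sub i ∘ₗ thetaLin R A M i) (sub j ∘ₗ thetaLin R A M j)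
  have hβ : β₁ = β₂ := by
    refine linearMap_ext (AlternatingMap.ext fun v => ?_)
    refine linearMap_ext (AlternatingMap.ext fun w => ?_)
    simp only [LinearMap.compAlternatingMap_apply, β₁, β₂, LinearMap.compr₂_apply,
      LinearMap.compl₁₂_apply, LinearMap.coe_comp, Function.comp_apply, LinearMap.mul_apply',
      sub, LinearMap.coe_restrictScalars, Submodule.coe_subtype, wedge_ιMulti, thetaLin_ιMulti,
      ιMulti_apply_coe, ExteriorAlgebra.ιMulti_apply]
    rw [← List.prod_append, ← List.ofFn_fin_append]
    congr 2
    funext x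
    refine Fin.addCases (fun l => ?_) (fun l => ?_) x <;> simp
  have := LinearMap.congr_fun₂ hβ x y
  simpa [β₁, β₂, sub] using this

omit [FiniteDimensional R M] in
/-- **Multiplicativity of `Θ`**: `Θ(x ∧ y) = Θ x ∧ Θ y` (in the exterior algebra over `A`). -/
lemma theta_wedge (k : ℕ) (x y : A ⊗[R] ⋀[R]^k M) :
    ((theta R A M (k + k) (LinearMap.BilinMap.baseChange A (wedge R M k k) x y) :
        ⋀[A]^(k + k) (A ⊗[R] M)) : ExteriorAlgebra A (A ⊗[R] M))
      = (theta R A M k x : ExteriorAlgebra A (A ⊗[R] M)) * (theta R A M k y) := by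
  induction x using TensorProduct.induction_on with
  | zero => simp
  | tmul a m =>
      induction y using TensorProduct.induction_on with
      | zero => simp
      | tmul a' m' =>
          simp only [LinearMap.BilinMap.baseChange_tmul, theta_tmul, Submodule.coe_smul,
            thetaLin_wedge, Algebra.smul_mul_assoc, Algebra.mul_smul_comm, smul_smul, mul_comm a' a]
      | add y y' hy hy' => simp only [map_add, hy, hy', Submodule.coe_add, mul_add]
  | add x x' hx hx' =>
      simp only [map_add, LinearMap.add_apply, hx, hx', Submodule.coe_add, add_mul]

omit [FiniteDimensional R M] in
/-- `Θ₁` and `oneEquiv`: `Θ₁ (a ⊗ v) = a • ι(1 ⊗ v)`, i.e. `Θ₁ ∘ (oneEquiv_R⁻¹)_A = oneEquiv_A⁻¹`. -/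
lemma theta_one_baseChange_oneEquiv_symm (w : A ⊗[R] M) :
    theta R A M 1 ((oneEquiv R M).symm.toLinearMap.baseChange A w)
      = (oneEquiv A (A ⊗[R] M)).symm w := by
  induction w using TensorProduct.induction_on with
  | zero => simp
  | tmul a v =>
      rw [LinearMap.baseChange_tmul, theta_tmul]
      have h1 : (oneEquiv R M).symm.toLinearMap v = ιMulti R 1 (fun _ => v) := by
        simp [oneEquiv_symm_apply]
      have h2 : (oneEquiv A (A ⊗[R] M)).symm (a ⊗ₜ[R] v)
          = a • ιMulti A 1 (fun _ => (1 : A) ⊗ₜ[R] v) := by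
        rw [show a ⊗ₜ[R] v = a • ((1 : A) ⊗ₜ[R] v) by simp [TensorProduct.smul_tmul'], map_smul]
        simp [oneEquiv_symm_apply]
      rw [h1, thetaLin_ιMulti, h2]
  | add x y hx hy => simp [map_add, hx, hy]

end BC

end

end HodgeCM.Toy
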